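import Mathlib

/-!
# SoloBlindTensorInductionSign — `TInd_H^G (Res_H R) ≅ Sym² R ⊕ Λ² R ⊗ η` for an index-two
# subgroup, in coordinates (PROPOSITION W♭-U, step (U2), the Asai route)

Solo seat `solo-Langlands-blind`, session 34 (second kernel anchor for referee note R62, "the one
place where a slip EXCHANGES the parities").  Session 33 anchored the FORM-theoretic derivation of
the conjugate-duality sign of `σ = ρ|_{G_K} ⊗ μ` (`SoloBlindConjugateDualSign`).  The ORIGINAL
(session 32) derivation went through the Asai representation
`As⁺(ρ|_{G_K} ⊗ μ) = TInd(ρ|_{G_K}) ⊗ (μ ∘ Ver) = (Sym² ρ ⊕ Λ² ρ ⊗ η) ⊗ ω⁻¹ η^e`, whose one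
convention-sensitive step is the decomposition of the tensor induction of a representation that
extends to the whole group:

  for `H ⊂ G` of index `2`, `s ∈ G ∖ H`, `η` the sign character of `G/H`, and `R : G → GL(V)`,
  `TInd_H^G (Res_H R)` is `V ⊗ V` with `g` acting by `(R(g) ⊗ R(g)) ∘ swap^{[g ∉ H]}`; the swap is
  `+1` on `Sym² V` and `−1` on `Λ² V`, so `TInd_H^G (Res_H R) ≅ Sym² R ⊕ Λ² R ⊗ η`.

Session 32 checked this only on `R = 1 ⊕ 1`; session 33 gave the one-line proof above.  This file
certifies it in coordinates for `dim V = 2` (the case used: `ρ` two-dimensional) over an arbitrary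
commutative ring, WITHOUT dividing by `2` (no splitting `V ⊗ V = Sym² ⊕ Λ²` is assumed; every
statement is about explicit vectors and operators):

* `swapMat_mul_kronecker` : the swap `P` intertwines, `P (M ⊗ N) = (N ⊗ M) P`; in particular
  `P` commutes with `M ⊗ M`, so the `±1`-eigenvectors of `P` are permuted among themselves by the
  whole action;
* `kronecker_mulVec_wedge` : on the antisymmetric vector `w = e₀ ⊗ e₁ − e₁ ⊗ e₀` an element of `H`
  acts by `det M` (`Λ² R = det R` on `H`);
* `kronecker_swap_mulVec_wedge` : an element of `G ∖ H` acts on `w` by `−det M`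
  (`Λ² R ⊗ η`: the sign character of `G/H` appears exactly here);
* `kronecker_swap_mulVec_of_symmetric` : on every swap-fixed vector an element of `G ∖ H` acts
  exactly as the diagonal `M ⊗ M` does (`Sym² R` with its untwisted `G`-action);
* `trace_kronecker_mul_swapMat` : the character identity `χ_{TInd Res R}(s) = tr((M ⊗ M) P) = tr(M²)
  = χ_R(s²)`, and `trace_kronecker_self` : `χ_{TInd Res R}(h) = (tr M)²`; with
  `trace_sq_fin_two` : `tr(M²) = (tr M)² − 2 det M` this is `χ_{Sym²}(s) − χ_{Λ²}(s)` resp.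
  `χ_{Sym²}(h) + χ_{Λ²}(h)` for `χ_{Sym² R} = (tr R)² − det R`, `χ_{Λ² R} = det R` — the virtual
  form of the same decomposition, valid for `2 × 2` matrices over any commutative ring.

Consequence used in W♭-U: with `R = ρ`, `H = G_K`, `det ρ = ω`, `η = η_{K/ℚ}`:
`As⁺(ρ|_{G_K}) = Sym² ρ ⊕ ω η`, `As⁻ = Sym² ρ ⊗ η ⊕ ω`; a slip in the sign on the `Λ²`-line would
exchange `As⁺` and `As⁻`, i.e. exchange "conjugate-orthogonal" and "conjugate-symplectic"
([GGP12, §7: `M` is conjugate-orthogonal iff `WD(k₀)` fixes a non-degenerate vector in `As⁺(M)`,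
conjugate-symplectic iff in `As⁻(M)`]; [Mok2012, §2.2 and Thm. 2.5.4 (a)]: parity `+1` = conjugate-
orthogonal, "following the terminology of section 3 of [GGP]") and hence the parities of the lock.
In GGP's model `As⁺(M) = M ⊗ M^s` with `s ↦ (1 ⊗ φ(s²)) ∘ swap`; for `M = Res_H R` the map
`x ⊗ y ↦ x ⊗ R(s) y` identifies the model used here (`h ↦ R(h) ⊗ R(h)`, `s ↦ (R(s) ⊗ R(s)) ∘ swap`)
with it, so `As⁺(Res_H R) = TInd_H^G(Res_H R)` with the UNTWISTED swap, as asserted.  The `SL₂`-sanity check of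
session 33 is repeated here in Asai form: `det M = 1` (`ρ` into `SL₂`, `μ = 1`) gives eigenvalue
`−1` for `s` on the `Λ²`-line, so the INVARIANT line sits in `As⁻`: conjugate-symplectic, as it must.

Not a step toward the summit `Summit.Langlands`; it certifies the algebra of one wall of the
seat's sharpest statement (census item 4, the parity front).
[cite: GanGrossPrasad2012, §3 and §7 (Astérisque 346; arXiv:0909.2999)]
[cite: Mok2012, §2.2, §2.4 and Thm. 2.5.4 (arXiv:1206.0882; Mem. AMS 1108, 2015)]
-/

namespace Summit.Langlands.Langlands.Theorems.SoloBlind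

open Matrix
open scoped Kronecker

section TensorInduction

variable {A : Type*} [CommRing A]

/-- The swap `x ⊗ y ↦ y ⊗ x` on `A² ⊗ A² = A^{2 × 2}` as a matrix: `(P v) (i, j) = v (j, i)`. -/
def swapMat : Matrix (Fin 2 × Fin 2) (Fin 2 × Fin 2) A :=
  Matrix.of fun p q => if q = p.swap then 1 else 0

/-- The antisymmetric vector `w = e₀ ⊗ e₁ − e₁ ⊗ e₀` (a generator of `Λ² A²` inside `A² ⊗ A²`). -/
def wedgeVec : Fin 2 × Fin 2 → A :=
  fun p => if p = (0, 1) then 1 else if p = (1, 0) then -1 else 0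

/-- `P v = v ∘ swap`. -/
theorem swapMat_mulVec (v : Fin 2 × Fin 2 → A) : swapMat *ᵥ v = fun p => v p.swap := by
  ext ⟨i, j⟩
  fin_cases i <;> fin_cases j <;>
    simp [swapMat, Matrix.mulVec, dotProduct]

/-- `P² = 1`. -/
theorem swapMat_mul_swapMat : (swapMat : Matrix _ _ A) * swapMat = 1 := by
  ext ⟨i, j⟩ ⟨k, l⟩
  fin_cases i <;> fin_cases j <;> fin_cases k <;> fin_cases l <;>
    simp [swapMat, Matrix.mul_apply, Fintype.sum_prod_type, Fin.sum_univ_two]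

/-- The swap INTERTWINES the Kronecker products: `P (M ⊗ N) = (N ⊗ M) P`.  In particular `P`
commutes with `M ⊗ M` (take `N = M`), so the diagonal action of `H` and the twisted action of
`G ∖ H` both preserve the `±1`-eigenvectors of `P`. -/
theorem swapMat_mul_kronecker (M N : Matrix (Fin 2) (Fin 2) A) :
    swapMat * (M ⊗ₖ N) = (N ⊗ₖ M) * swapMat := by
  ext ⟨i, j⟩ ⟨k, l⟩
  fin_cases i <;> fin_cases j <;> fin_cases k <;> fin_cases l <;>
    simp [swapMat, Matrix.mul_apply, Fintype.sum_prod_type, Fin.sum_univ_two] <;> ring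

/-- `P w = −w`: the wedge vector is the `−1`-eigenvector of the swap. -/
theorem swapMat_mulVec_wedge : swapMat *ᵥ (wedgeVec : Fin 2 × Fin 2 → A) = -wedgeVec := by
  rw [swapMat_mulVec]
  ext ⟨i, j⟩
  fin_cases i <;> fin_cases j <;> simp [wedgeVec]

/-- `Λ²` on `H`: an element `h ∈ H` acts on `V ⊗ V` by `M ⊗ M` (`M = R(h)`), and on the wedge
vector by the scalar `det M`. -/
theorem kronecker_mulVec_wedge (M : Matrix (Fin 2) (Fin 2) A) :
    (M ⊗ₖ M) *ᵥ wedgeVec = M.det • (wedgeVec : Fin 2 × Fin 2 → A) := by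
  ext ⟨i, j⟩
  fin_cases i <;> fin_cases j <;>
    simp [wedgeVec, Matrix.mulVec, dotProduct, Fintype.sum_prod_type, Fin.sum_univ_two,
      Matrix.det_fin_two] <;> ring

/-- `Λ² ⊗ η` on `G ∖ H`: an element `s ∉ H` acts on `V ⊗ V` by `(M ⊗ M) P` (`M = R(s)`), and on
the wedge vector by the scalar `−det M` — the sign character `η` of `G/H` appears exactly here. -/
theorem kronecker_swap_mulVec_wedge (M : Matrix (Fin 2) (Fin 2) A) :
    ((M ⊗ₖ M) * swapMat) *ᵥ wedgeVec = (-M.det) • (wedgeVec : Fin 2 × Fin 2 → A) := by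
  rw [← Matrix.mulVec_mulVec, swapMat_mulVec_wedge, Matrix.mulVec_neg, kronecker_mulVec_wedge,
    neg_smul]

/-- `Sym²` untwisted: on every swap-fixed vector (`P v = v`, i.e. `v ∈ Sym² V`) an element
`s ∉ H` acts exactly as the diagonal operator `M ⊗ M` does. -/
theorem kronecker_swap_mulVec_of_symmetric (M : Matrix (Fin 2) (Fin 2) A)
    (v : Fin 2 × Fin 2 → A) (hv : swapMat *ᵥ v = v) :
    ((M ⊗ₖ M) * swapMat) *ᵥ v = (M ⊗ₖ M) *ᵥ v := by
  rw [← Matrix.mulVec_mulVec, hv]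

/-- … and the diagonal action preserves swap-fixedness (so `Sym² V` is a sub-representation for
the whole of `G`): if `P v = v` then `P ((M ⊗ M) v) = (M ⊗ M) v`. -/
theorem swapMat_mulVec_kronecker_of_symmetric (M : Matrix (Fin 2) (Fin 2) A)
    (v : Fin 2 × Fin 2 → A) (hv : swapMat *ᵥ v = v) :
    swapMat *ᵥ ((M ⊗ₖ M) *ᵥ v) = (M ⊗ₖ M) *ᵥ v := by
  rw [Matrix.mulVec_mulVec, swapMat_mul_kronecker, ← Matrix.mulVec_mulVec, hv]

/-- Character of the tensor induction OFF the subgroup: `tr((M ⊗ M) P) = tr(M²)`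
(`χ_{TInd Res R}(s) = χ_R(s²)`). -/
theorem trace_kronecker_mul_swapMat (M : Matrix (Fin 2) (Fin 2) A) :
    ((M ⊗ₖ M) * swapMat).trace = (M * M).trace := by
  simp [Matrix.trace, Matrix.diag, Matrix.mul_apply, Fintype.sum_prod_type, Fin.sum_univ_two,
    swapMat]

/-- Character of the tensor induction ON the subgroup: `tr(M ⊗ M) = (tr M)²`
(`χ_{TInd Res R}(h) = χ_R(h)²`). -/
theorem trace_kronecker_self (M : Matrix (Fin 2) (Fin 2) A) :
    (M ⊗ₖ M).trace = M.trace ^ 2 := by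
  simp [Matrix.trace, Matrix.diag, Fintype.sum_prod_type, Fin.sum_univ_two]
  ring

/-- `2 × 2` Newton identity: `tr(M²) = (tr M)² − 2 det M`. -/
theorem trace_sq_fin_two (M : Matrix (Fin 2) (Fin 2) A) :
    (M * M).trace = M.trace ^ 2 - 2 * M.det := by
  simp [Matrix.trace, Matrix.diag, Matrix.mul_apply, Fin.sum_univ_two, Matrix.det_fin_two]
  ring

/-- The VIRTUAL decomposition `χ_{TInd Res R} = χ_{Sym² R} + η · χ_{Λ² R}` for `2`-dimensional `R`
(`χ_{Sym²} = tr² − det`, `χ_{Λ²} = det`): off the subgroup the `Λ²`-character enters with a MINUS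
sign … -/
theorem trace_tensorInduction_off (M : Matrix (Fin 2) (Fin 2) A) :
    ((M ⊗ₖ M) * swapMat).trace = (M.trace ^ 2 - M.det) - M.det := by
  rw [trace_kronecker_mul_swapMat, trace_sq_fin_two]; ring

/-- … and on the subgroup with a PLUS sign. -/
theorem trace_tensorInduction_on (M : Matrix (Fin 2) (Fin 2) A) :
    (M ⊗ₖ M).trace = (M.trace ^ 2 - M.det) + M.det := by
  rw [trace_kronecker_self]; ring

/-- `SL₂`-sanity (session 33's check in Asai form): if `det M = 1` then `s` acts on the wedge line
by `−1`, so the invariant line of `TInd` twisted by `η` — i.e. of `As⁻` — is the one that survives: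
`ρ|_{G_K}` with `ρ` into `SL₂` is conjugate-SYMPLECTIC. -/
example (M : Matrix (Fin 2) (Fin 2) A) (hM : M.det = 1) :
    ((M ⊗ₖ M) * swapMat) *ᵥ wedgeVec = -(wedgeVec : Fin 2 × Fin 2 → A) ∧
      (M ⊗ₖ M) *ᵥ wedgeVec = (wedgeVec : Fin 2 × Fin 2 → A) := by
  rw [kronecker_swap_mulVec_wedge, kronecker_mulVec_wedge, hM, neg_smul, one_smul]
  exact ⟨rfl, rfl⟩

end TensorInduction

end Summit.Langlands.Langlands.Theorems.SoloBlind
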